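import Literature.NumberTheory.Sieve.LinearEquationsInPrimesGvNBoxes
import Literature.NumberTheory.Sieve.ConvexBodyLatticePoints
import Mathlib.Analysis.SpecialFunctions.Pow.Continuity
import HarnessLib

/-!
# The generalised von Neumann theorem (Green–Tao 2010, Prop. 7.1): discharge

Trunk T-SIEVE (`Literature/NumberTheory/Sieve`). Last file of the App. B/C layer of the
decomposition of `Literature.NumberTheory.Sieve.GreenTaoZiegler2012_finiteComplexity`: the proof of
`Literature.NumberTheory.Sieve.GreenTao2010_generalisedVonNeumann_holds`, discharging the named fact
`Literature.NumberTheory.Sieve.GreenTao2010_generalisedVonNeumann` (`LinearEquationsInPrimesPseudorandom.lean`), i.e.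
Proposition 7.1 of B. Green, T. Tao, *Linear equations in primes*, Ann. of Math. 171 (2010)
(the generalised von Neumann theorem relative to a pseudorandom majorant), with `C₁ = 8` and
`D = Literature.boxDegree s t d L`.

The argument is that of App. C of the source (embed `[N]` in `ℤ_{N'}`, remove the convex cutoff,
apply the Gowers–Cauchy–Schwarz machinery of App. B/C), with the removal of the cutoff `1_K`
organised through a smooth partition of unity rather than the Lipschitz approximations of
Cor. A.3 and Fourier expansion:

* geometry (App. A): the cells of a grid of mesh `ρ ≍ ε₁ N` whose enlarged box meets `∂K`
  number `O_d((N/ρ)^{d-1})` (`Literature.NumberTheory.Sieve.card_boundaryCells_le`), by the coordinatewise Cavalieri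
  estimates `Literature.NumberTheory.Sieve.LatticePointsConvexBody.volume_outer_le` / `volume_le_inner` applied three
  times to the rescaled body and Gauss's lattice point comparison
  (`card_le_volume_outer`, `volume_inner_le_card`);
* transfer (App. C, "embed `[N]` inside `ℤ_{N'}`"): the mollified sum over a cell equals a
  mollified multilinear average over `ℤ_{N'}^d` (`Literature.NumberTheory.Sieve.sum_boxCut_eq_sum_boxCutZ`);
* the cells: interior cells are bounded by `Literature.NumberTheory.Sieve.box_bound` for the extensions by zero
  (`Literature.NumberTheory.Sieve.interiorCell_bound`, Gowers-norm input `‖f_{j₀}‖_{U^{s+1}[N]} ≤ δ` via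
  `Literature.NumberTheory.Sieve.gowersPower_extendByZero_le`, Lemma B.5); arbitrary cells by the majorant, expanding
  `ν = 1 + 2 · (ν - 1)/2` into `3^t` terms each bounded by `Literature.NumberTheory.Sieve.box_bound` for a subsystem with
  majorant `ν♯` (`Literature.NumberTheory.Sieve.cell_bound_majorant`, as in the estimate of `𝔼 G_ε ∏ ν(ψ_i)` of App. C);
  exterior cells vanish; the decomposition `∑_{K ∩ ℤ^d} = ∑_cells` (`Literature.NumberTheory.Sieve.sum_eq_sum_cells`);
* the final choice of `ε₁, ρ, q, η, δ, N₀` (`Literature.NumberTheory.Sieve.GreenTao2010_generalisedVonNeumann_holds`).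

## References

* B. Green, T. Tao, *Linear equations in primes*, Ann. of Math. (2) 171 (2010), 1753–1850
  (arXiv:math/0606088): Prop. 7.1 and App. C; App. A (Lemma A.1, Cor. A.2); App. B (Lemma B.5).
-/

noncomputable section

open Finset
open scoped BigOperators

namespace Literature.NumberTheory.Sieve

/-! ### Geometry: counting the boundary boxes of a grid (Green–Tao 2010, App. A) -/

section geometry

open Set MeasureTheory LatticePointsConvexBody
open scoped Pointwise ENNReal

variable {n : ℕ}

/-- The closed box `C_m = ∏_e [m_e ρ - q, (m_e + 1) ρ + q]` carrying the support of the smooth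
cutoff of the grid cell `m`. [folklore] -/
def cellBox (ρ q : ℕ) (m : Fin (n + 1) → ℤ) : Set (Fin (n + 1) → ℝ) :=
  Icc (fun e => ((m e * ρ - q : ℤ) : ℝ)) (fun e => (((m e + 1) * ρ + q : ℤ) : ℝ))

/-- The rescaled body `K'' = ρ⁻¹ K - ½ 𝟙 = {u : ρ (u + ½) ∈ K}`. [folklore] -/
def rescaledBody (ρ : ℕ) (K : Set (Fin (n + 1) → ℝ)) : Set (Fin (n + 1) → ℝ) :=
  {u | (fun e => (ρ : ℝ) * (u e + 1 / 2)) ∈ K}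

/-- `K''` is convex. [folklore] -/
theorem convex_rescaledBody (ρ : ℕ) {K : Set (Fin (n + 1) → ℝ)} (hK : Convex ℝ K) :
    Convex ℝ (rescaledBody ρ K) := by
  intro x hx y hy a b ha hb hab
  show (fun e => (ρ : ℝ) * ((a • x + b • y) e + 1 / 2)) ∈ K
  have : (fun e => (ρ : ℝ) * ((a • x + b • y) e + 1 / 2)) =
      a • (fun e => (ρ : ℝ) * (x e + 1 / 2)) + b • (fun e => (ρ : ℝ) * (y e + 1 / 2)) := by
    funext e
    simp only [Pi.add_apply, Pi.smul_apply, smul_eq_mul]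
    linear_combination (-(ρ : ℝ) / 2) * hab
  rw [this]
  exact hK hx hy ha hb hab

/-- `K'' ⊆ [-(N/ρ + 2), N/ρ + 2]^{d}` for `K ⊆ [-N, N]^d`. [folklore] -/
theorem rescaledBody_subset {ρ : ℕ} (hρ : 1 ≤ ρ) {K : Set (Fin (n + 1) → ℝ)} {N : ℕ}
    (hKN : K ⊆ realBox (n + 1) N) : rescaledBody ρ K ⊆ realBox (n + 1) ((N / ρ + 2 : ℕ) : ℝ) := by
  intro u hu
  have hx := hKN hu
  have hρ' : (0 : ℝ) < ρ := by exact_mod_cast hρ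
  have hdiv : (N : ℝ) / ρ ≤ ((N / ρ : ℕ) : ℝ) + 1 := by
    rw [div_le_iff₀ hρ']
    have := Nat.lt_div_mul_add (a := N) hρ
    have h' : ((N : ℕ) : ℝ) < ((N / ρ * ρ + ρ : ℕ) : ℝ) := by exact_mod_cast this
    push_cast at h'
    nlinarith
  constructor
  · intro e
    have h1 : -(N : ℝ) ≤ (ρ : ℝ) * (u e + 1 / 2) := hx.1 e
    show -(((N / ρ + 2 : ℕ) : ℝ)) ≤ u e
    push_cast
    have : -(N : ℝ) / ρ ≤ u e + 1 / 2 := by rw [div_le_iff₀ hρ']; linarith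
    have h2 : -(N : ℝ) / ρ = -((N : ℝ) / ρ) := by ring
    linarith
  · intro e
    have h1 : (ρ : ℝ) * (u e + 1 / 2) ≤ N := hx.2 e
    show u e ≤ ((N / ρ + 2 : ℕ) : ℝ)
    push_cast
    have : u e + 1 / 2 ≤ (N : ℝ) / ρ := by rw [le_div_iff₀ hρ']; linarith
    linarith

/-- The rescaled points of a cell box are within `[-1, 1]^d` of its index (`2q ≤ ρ`). [folklore] -/
theorem abs_rescale_sub_le {ρ q : ℕ} (hρ : 1 ≤ ρ) (hq : 2 * q ≤ ρ) {m : Fin (n + 1) → ℤ}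
    {x : Fin (n + 1) → ℝ} (hx : x ∈ cellBox ρ q m) (e : Fin (n + 1)) :
    |(x e / ρ - 1 / 2) - m e| ≤ 1 := by
  have hρ' : (0 : ℝ) < ρ := by exact_mod_cast hρ
  have hq' : 2 * (q : ℝ) ≤ ρ := by exact_mod_cast hq
  obtain ⟨h1, h2⟩ := hx
  have h1 := h1 e; have h2 := h2 e
  simp only [Int.cast_sub, Int.cast_mul, Int.cast_natCast, Int.cast_add, Int.cast_one] at h1 h2
  rw [abs_le]
  constructor
  · have : ((m e : ℝ) * ρ - q) / ρ ≤ x e / ρ := div_le_div_of_nonneg_right h1 hρ'.le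
    rw [sub_div, mul_div_cancel_right₀ _ hρ'.ne'] at this
    have hq2 : (q : ℝ) / ρ ≤ 1 / 2 := by rw [div_le_iff₀ hρ']; linarith
    linarith
  · have : x e / ρ ≤ (((m e : ℝ) + 1) * ρ + q) / ρ := div_le_div_of_nonneg_right h2 hρ'.le
    rw [add_div, mul_div_cancel_right₀ _ hρ'.ne'] at this
    have hq2 : (q : ℝ) / ρ ≤ 1 / 2 := by rw [div_le_iff₀ hρ']; linarith
    linarith

/-- Half of a vector of `[-1,1]^d` lies in the unit partial cube. [folklore] -/
theorem half_mem_pcube {z : Fin (n + 1) → ℝ} (hz : ∀ e, |z e| ≤ 1) :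
    (fun e => z e / 2) ∈ pcube (Finset.univ : Finset (Fin (n + 1))) := by
  rw [mem_pcube]
  intro e
  refine ⟨fun _ => ?_, fun h => absurd (Finset.mem_univ e) h⟩
  rw [abs_div, abs_two]
  linarith [hz e]

/-- **Boundary cells are near the boundary**: if the cell box `C_m` meets `K` then `m` lies in
the double outer parallel body of `K''`. [folklore] -/
theorem mem_outer_outer_of_meets {ρ q : ℕ} (hρ : 1 ≤ ρ) (hq : 2 * q ≤ ρ) {K : Set (Fin (n + 1) → ℝ)}
    {m : Fin (n + 1) → ℤ} (h : (cellBox ρ q m ∩ K).Nonempty) :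
    realPoint m ∈ outer (outer (rescaledBody ρ K) Finset.univ) Finset.univ := by
  obtain ⟨x, hxC, hxK⟩ := h
  have hρ' : (0 : ℝ) < ρ := by exact_mod_cast hρ
  set u : Fin (n + 1) → ℝ := fun e => x e / ρ - 1 / 2 with hu
  have huK : u ∈ rescaledBody ρ K := by
    show (fun e => (ρ : ℝ) * (u e + 1 / 2)) ∈ K
    have : (fun e => (ρ : ℝ) * (u e + 1 / 2)) = x := by
      funext e; simp only [hu]; field_simp; ring
    rw [this]; exact hxK
  have hz : ∀ e, |(realPoint m - u) e| ≤ 1 := fun e => by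
    rw [Pi.sub_apply, abs_sub_comm]; exact abs_rescale_sub_le hρ hq hxC e
  -- `m = (u + (m-u)/2) + (m-u)/2`
  refine Set.mem_add.mpr ⟨u + fun e => (realPoint m - u) e / 2,
    Set.mem_add.mpr ⟨u, huK, _, half_mem_pcube hz, rfl⟩, fun e => (realPoint m - u) e / 2,
    half_mem_pcube hz, ?_⟩
  funext e; simp only [Pi.add_apply, Pi.sub_apply]; ring

/-- **Interior detection**: if `m` lies in the double inner parallel body of `K''` then the cell
box `C_m` is contained in `K`. [folklore] -/
theorem cellBox_subset_of_mem_inner_inner {ρ q : ℕ} (hρ : 1 ≤ ρ) (hq : 2 * q ≤ ρ)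
    {K : Set (Fin (n + 1) → ℝ)} {m : Fin (n + 1) → ℤ}
    (h : realPoint m ∈ inner (inner (rescaledBody ρ K) Finset.univ) Finset.univ) :
    cellBox ρ q m ⊆ K := by
  intro x hxC
  have hρ' : (0 : ℝ) < ρ := by exact_mod_cast hρ
  set u : Fin (n + 1) → ℝ := fun e => x e / ρ - 1 / 2 with hu
  have hz : ∀ e, |(u - realPoint m) e| ≤ 1 := fun e => abs_rescale_sub_le hρ hq hxC e
  have h1 := h (fun e => (u - realPoint m) e / 2) (half_mem_pcube hz)
    (fun e => (u - realPoint m) e / 2) (half_mem_pcube hz)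
  have heq : realPoint m + (fun e => (u - realPoint m) e / 2) + (fun e => (u - realPoint m) e / 2) = u := by
    funext e; simp only [Pi.add_apply, Pi.sub_apply]; ring
  rw [heq] at h1
  have : (fun e => (ρ : ℝ) * (u e + 1 / 2)) = x := by
    funext e; simp only [hu]; field_simp; ring
  rw [← this]; exact h1

/-- Iterated outer parallel bodies gain little volume. [folklore] -/
theorem volume_outer_three_le {K : Set (Fin (n + 1) → ℝ)} (hK : Convex ℝ K) {M : ℝ}
    (hKM : K ⊆ realBox (n + 1) M) :
    volume (outer (outer (outer K Finset.univ) Finset.univ) Finset.univ) ≤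
      volume K + 3 * ((n + 1 : ℕ) * volume (Icc (fun _ : Fin n => -(M + 3)) (fun _ => M + 3))) := by
  have hcard : (Finset.univ : Finset (Fin (n + 1))).card = n + 1 := by simp
  set B : Set (Fin n → ℝ) := Icc (fun _ : Fin n => -(M + 3)) (fun _ => M + 3) with hB
  have hb : ∀ M' : ℝ, M' + 1 ≤ M + 3 →
      volume (Icc (fun _ : Fin n => -(M' + 1)) (fun _ => M' + 1)) ≤ volume B := fun M' hM' =>
    measure_mono (Set.Icc_subset_Icc (fun _ => by simp only; linarith) (fun _ => by simp only; linarith))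
  have h1 := volume_outer_le hK hKM Finset.univ
  have h2 := volume_outer_le (convex_outer hK Finset.univ) (outer_subset_realBox hKM Finset.univ)
    Finset.univ
  have h3 := volume_outer_le (convex_outer (convex_outer hK Finset.univ) Finset.univ)
    (outer_subset_realBox (outer_subset_realBox hKM Finset.univ) Finset.univ) Finset.univ
  rw [hcard] at h1 h2 h3
  have h1' : volume (outer K Finset.univ) ≤ volume K + (n + 1 : ℕ) * volume B :=
    h1.trans (add_le_add le_rfl (mul_le_mul_right (hb M (by linarith)) _))
  have h2' : volume (outer (outer K Finset.univ) Finset.univ) ≤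
      volume (outer K Finset.univ) + (n + 1 : ℕ) * volume B :=
    h2.trans (add_le_add le_rfl (mul_le_mul_right (hb (M + 1) (by linarith)) _))
  have h3' : volume (outer (outer (outer K Finset.univ) Finset.univ) Finset.univ) ≤
      volume (outer (outer K Finset.univ) Finset.univ) + (n + 1 : ℕ) * volume B :=
    h3.trans (add_le_add le_rfl (mul_le_mul_right (hb (M + 1 + 1) (by linarith)) _))
  calc volume (outer (outer (outer K Finset.univ) Finset.univ) Finset.univ)
      ≤ volume K + (n + 1 : ℕ) * volume B + (n + 1 : ℕ) * volume B + (n + 1 : ℕ) * volume B :=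
        h3'.trans (add_le_add (h2'.trans (add_le_add h1' le_rfl)) le_rfl)
    _ = _ := by ring

/-- Iterated inner parallel bodies lose little volume. [folklore] -/
theorem volume_le_inner_three {K : Set (Fin (n + 1) → ℝ)} (hK : Convex ℝ K) {M : ℝ}
    (hKM : K ⊆ realBox (n + 1) M) :
    volume K ≤ volume (inner (inner (inner K Finset.univ) Finset.univ) Finset.univ) +
      3 * ((n + 1 : ℕ) * volume (Icc (fun _ : Fin n => -M) (fun _ => M))) := by
  have hcard : (Finset.univ : Finset (Fin (n + 1))).card = n + 1 := by simp
  set B : Set (Fin n → ℝ) := Icc (fun _ : Fin n => -M) (fun _ => M) with hB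
  have hs1 : inner K Finset.univ ⊆ realBox (n + 1) M := (inner_subset Finset.univ).trans hKM
  have hs2 : inner (inner K Finset.univ) Finset.univ ⊆ realBox (n + 1) M :=
    (inner_subset Finset.univ).trans hs1
  have h1 := volume_le_inner hK hKM Finset.univ
  have h2 := volume_le_inner (K := inner K Finset.univ) (convex_inner hK Finset.univ) hs1 Finset.univ
  have h3 := volume_le_inner (K := inner (inner K Finset.univ) Finset.univ)
    (convex_inner (convex_inner hK Finset.univ) Finset.univ) hs2 Finset.univ
  rw [hcard] at h1 h2 h3
  calc volume K ≤ volume (inner (inner (inner K Finset.univ) Finset.univ) Finset.univ) +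
        (n + 1 : ℕ) * volume B + (n + 1 : ℕ) * volume B + (n + 1 : ℕ) * volume B :=
        h1.trans (add_le_add (h2.trans (add_le_add h3 le_rfl)) le_rfl)
    _ = _ := by ring

open Classical in
/-- **The number of boundary cells**: the cells of mesh `ρ` whose box `C_m` (enlarged by `q ≤ ρ/2`)
meets the convex body `K ⊆ [-N,N]^d` without being contained in it number
`O_d((N/ρ + 1)^{d-1})` — a thickened-boundary estimate from the coordinatewise Cavalieri lemmas
of App. A. [cite: GreenTao2010, App. A (Lemma A.1, Cor. A.2)] -/
theorem card_boundaryCells_le {N ρ q : ℕ} (hρ : 1 ≤ ρ) (hq : 2 * q ≤ ρ)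
    {K : Set (Fin (n + 1) → ℝ)} (hK : Convex ℝ K) (hKN : K ⊆ realBox (n + 1) N)
    (Ms : Finset (Fin (n + 1) → ℤ)) (hMs : Ms ⊆ latticeBox (n + 1) (N / ρ + 2)) :
    ((Ms.filter fun m => (cellBox ρ q m ∩ K).Nonempty ∧ ¬ cellBox ρ q m ⊆ K).card : ℝ) ≤
      6 * (n + 1) * (2 * ((N / ρ + 2 : ℕ) : ℝ) + 6) ^ n := by
  set M : ℕ := N / ρ + 2 with hM
  set K'' := rescaledBody ρ K with hK''
  have hK''c : Convex ℝ K'' := convex_rescaledBody ρ hK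
  have hK''M : K'' ⊆ realBox (n + 1) (M : ℝ) := rescaledBody_subset hρ hKN
  set F₁ := (latticeBox (n + 1) M).filter fun m =>
    realPoint m ∈ outer (outer K'' Finset.univ) Finset.univ with hF₁
  set F₂ := (latticeBox (n + 1) M).filter fun m =>
    realPoint m ∈ inner (inner K'' Finset.univ) Finset.univ with hF₂
  -- the boundary cells inject into `F₁ \\ F₂`
  have hsub : (Ms.filter fun m => (cellBox ρ q m ∩ K).Nonempty ∧ ¬ cellBox ρ q m ⊆ K) ⊆ F₁ \ F₂ := by
    intro m hm
    obtain ⟨hm1, hm2, hm3⟩ := Finset.mem_filter.mp hm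
    refine Finset.mem_sdiff.mpr ⟨Finset.mem_filter.mpr ⟨hMs hm1, mem_outer_outer_of_meets hρ hq hm2⟩,
      fun h => hm3 (cellBox_subset_of_mem_inner_inner hρ hq (Finset.mem_filter.mp h).2)⟩
  have hF₂F₁ : F₂ ⊆ F₁ := by
    intro m hm
    obtain ⟨hm1, hm2⟩ := Finset.mem_filter.mp hm
    refine Finset.mem_filter.mpr ⟨hm1, ?_⟩
    have hmK : realPoint m ∈ K'' := inner_subset _ (inner_subset _ hm2)
    exact Set.mem_add.mpr ⟨realPoint m, Set.mem_add.mpr ⟨realPoint m, hmK, 0,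
      (mem_pcube.mpr fun _ => ⟨fun _ => by simp, fun h => absurd (Finset.mem_univ _) h⟩), add_zero _⟩,
      0, (mem_pcube.mpr fun _ => ⟨fun _ => by simp, fun h => absurd (Finset.mem_univ _) h⟩), add_zero _⟩
  have hcard : ((Ms.filter fun m => (cellBox ρ q m ∩ K).Nonempty ∧ ¬ cellBox ρ q m ⊆ K).card : ℝ) ≤
      (F₁.card : ℝ) - F₂.card := by
    have := Finset.card_le_card hsub
    rw [Finset.card_sdiff_of_subset hF₂F₁] at this
    have h' := Finset.card_le_card hF₂F₁
    rw [le_sub_iff_add_le]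
    exact_mod_cast (by omega : _ + F₂.card ≤ F₁.card)
  refine hcard.trans ?_
  -- volumes
  set B₁ : Set (Fin n → ℝ) := Icc (fun _ : Fin n => -((M : ℝ) + 3)) (fun _ => (M : ℝ) + 3)
  set B₀ : Set (Fin n → ℝ) := Icc (fun _ : Fin n => -(M : ℝ)) (fun _ => (M : ℝ))
  have hM0 : (0 : ℝ) ≤ M := Nat.cast_nonneg M
  have hB₁ : (volume B₁).toReal = (2 * (M + 3)) ^ n := by
    rw [Real.volume_Icc_pi_toReal (fun _ => by simp only; linarith)]
    simp only [Finset.prod_const, Finset.card_univ, Fintype.card_fin]; ring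
  have hB₀ : (volume B₀).toReal = (2 * M) ^ n := by
    rw [Real.volume_Icc_pi_toReal (fun _ => by simp only; linarith)]
    simp only [Finset.prod_const, Finset.card_univ, Fintype.card_fin]; ring
  have hKt : volume K'' ≠ ⊤ :=
    ((measure_mono hK''M).trans_lt (isCompact_Icc.measure_lt_top)).ne
  have hB₁t : volume B₁ ≠ ⊤ := isCompact_Icc.measure_lt_top.ne
  have hB₀t : volume B₀ ≠ ⊤ := isCompact_Icc.measure_lt_top.ne
  have hR1 : volume K'' + 3 * ((n + 1 : ℕ) * volume B₁) ≠ ⊤ :=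
    ENNReal.add_ne_top.mpr ⟨hKt, ENNReal.mul_ne_top (by simp) (ENNReal.mul_ne_top (by simp) hB₁t)⟩
  have hR2 : (F₂.card : ℝ≥0∞) + 3 * ((n + 1 : ℕ) * volume B₀) ≠ ⊤ :=
    ENNReal.add_ne_top.mpr ⟨by simp, ENNReal.mul_ne_top (by simp) (ENNReal.mul_ne_top (by simp) hB₀t)⟩
  have h1 : (F₁.card : ℝ≥0∞) ≤ volume K'' + 3 * ((n + 1 : ℕ) * volume B₁) :=
    (card_le_volume_outer (N := M) _).trans (volume_outer_three_le hK''c hK''M)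
  have h2 : volume K'' ≤ F₂.card + 3 * ((n + 1 : ℕ) * volume B₀) :=
    (volume_le_inner_three hK''c hK''M).trans (by
      gcongr
      exact volume_inner_le_card ((inner_subset _).trans ((inner_subset _).trans hK''M)))
  have h1' : (F₁.card : ℝ) ≤ (volume K'').toReal + 3 * ((n + 1) * (2 * (M + 3)) ^ n) := by
    have := ENNReal.toReal_mono hR1 h1
    rw [ENNReal.toReal_add hKt (ENNReal.mul_ne_top (by simp) (ENNReal.mul_ne_top (by simp) hB₁t)),
      ENNReal.toReal_mul, ENNReal.toReal_mul, hB₁] at this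
    simp only [ENNReal.toReal_natCast, ENNReal.toReal_ofNat] at this
    push_cast at this
    exact this
  have h2' : (volume K'').toReal ≤ F₂.card + 3 * ((n + 1) * (2 * M) ^ n) := by
    have := ENNReal.toReal_mono hR2 h2
    rw [ENNReal.toReal_add (by simp) (ENNReal.mul_ne_top (by simp) (ENNReal.mul_ne_top (by simp) hB₀t)),
      ENNReal.toReal_mul, ENNReal.toReal_mul, hB₀] at this
    simp only [ENNReal.toReal_natCast, ENNReal.toReal_ofNat] at this
    push_cast at this
    exact this
  have hp : (2 * (M : ℝ)) ^ n ≤ (2 * (M : ℝ) + 6) ^ n :=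
    pow_le_pow_left₀ (by positivity) (by linarith) n
  have : (2 * ((M : ℝ) + 3)) ^ n = (2 * (M : ℝ) + 6) ^ n := by ring
  nlinarith [this, hp]

end geometry

/-! ### Transfer of mollified box sums from `ℤ^d` to `ℤ_{N'}^d` -/

section transfer

open LatticePointsConvexBody

variable {n : ℕ} {N' : ℕ} [NeZero N']

/-- The smooth cutoff of the cell `m` on `ℤ^d`: `Φ_m(x) = ∏_e trapZ(I_{m_e})(x_e)`. [folklore] -/
def boxCut (ρ q : ℕ) (m x : Fin (n + 1) → ℤ) : ℝ :=
  ∏ e, trapZ (gridIco ρ (m e)) q (x e)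

/-- The integer support box of `Φ_m`: `∏_e (m_e ρ - q, (m_e + 1) ρ + q)`. [folklore] -/
def suppBox (ρ q : ℕ) (m : Fin (n + 1) → ℤ) : Finset (Fin (n + 1) → ℤ) :=
  Fintype.piFinset fun e => Finset.Ioo (m e * ρ - q) ((m e + 1) * ρ + q)

/-- The smooth cutoff of the cell `m` on `ℤ_{N'}^d`: `∏_e (1_{Ĩ_{m_e}} ∗ μ_q ∗ μ_{-q})(y_e)`. [folklore] -/
def boxCutZ (N' ρ q : ℕ) (m : Fin (n + 1) → ℤ) (y : Fin (n + 1) → ZMod N') : ℝ :=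
  ∏ e, apSmooth (zmodInd N' (gridIco ρ (m e))) 1 q (y e)

omit [NeZero N'] in
/-- `0 ≤ Φ_m ≤ 1`. [folklore] -/
theorem boxCut_nonneg (ρ q : ℕ) (m x : Fin (n + 1) → ℤ) : 0 ≤ boxCut ρ q m x :=
  Finset.prod_nonneg fun _ _ => trapZ_nonneg _ _ _

omit [NeZero N'] in
/-- `Φ_m ≤ 1`. [folklore] -/
theorem boxCut_le_one (ρ q : ℕ) (m x : Fin (n + 1) → ℤ) : boxCut ρ q m x ≤ 1 :=
  Finset.prod_le_one (fun _ _ => trapZ_nonneg _ _ _) fun _ _ => trapZ_le_one _ _ _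

omit [NeZero N'] in
/-- `Φ_m` is supported on the support box. [folklore] -/
theorem mem_suppBox_of_boxCut_ne_zero {ρ q : ℕ} {m x : Fin (n + 1) → ℤ}
    (h : boxCut ρ q m x ≠ 0) : x ∈ suppBox ρ q m := by
  refine Fintype.mem_piFinset.mpr fun e => Finset.mem_Ioo.mpr ?_
  have := trapZ_Ico_ne_zero (Finset.prod_ne_zero_iff.mp h e (Finset.mem_univ e))
  exact this

omit [NeZero N'] in
/-- Points of the support box lie in the cell box. [folklore] -/
theorem realPoint_mem_cellBox {ρ q : ℕ} {m x : Fin (n + 1) → ℤ} (h : x ∈ suppBox ρ q m) :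
    realPoint x ∈ cellBox ρ q m := by
  have h' := Fintype.mem_piFinset.mp h
  constructor <;> intro e <;> have := Finset.mem_Ioo.mp (h' e) <;> simp only [realPoint] <;>
    exact_mod_cast (by omega : _)

omit [NeZero N'] in
/-- Coordinates of the support box of an admissible cell are bounded by `R` when
`(|m_e| + 1) ρ + q ≤ R`. [folklore] -/
theorem abs_le_of_mem_suppBox {ρ q : ℕ} {m x : Fin (n + 1) → ℤ} (h : x ∈ suppBox ρ q m) {R : ℤ}
    (hR : ∀ e, (|m e| + 1) * ρ + q ≤ R) (e : Fin (n + 1)) : |x e| ≤ R := by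
  have := Finset.mem_Ioo.mp (Fintype.mem_piFinset.mp h e)
  have hR := hR e
  have hρ : (0 : ℤ) ≤ ρ := by positivity
  rw [abs_le]
  rcases le_or_gt 0 (m e) with hm | hm
  · rw [abs_of_nonneg hm] at hR; constructor <;> nlinarith
  · rw [abs_of_neg hm] at hR; constructor <;> nlinarith

omit [NeZero N'] in
/-- The grid interval of an admissible cell lies in `[-R, R]`. [folklore] -/
theorem abs_le_of_mem_gridIco {ρ q : ℕ} {m : Fin (n + 1) → ℤ} {R : ℤ}
    (hR : ∀ e, (|m e| + 1) * ρ + q ≤ R) (e : Fin (n + 1)) {z : ℤ} (hz : z ∈ gridIco ρ (m e)) :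
    |z| ≤ R := by
  unfold gridIco at hz
  have := Finset.mem_Ico.mp hz
  have hR := hR e
  have hρ : (0 : ℤ) ≤ ρ := by positivity
  have hq : (0 : ℤ) ≤ q := by positivity
  rw [abs_le]
  rcases le_or_gt 0 (m e) with hm | hm
  · rw [abs_of_nonneg hm] at hR; constructor <;> nlinarith
  · rw [abs_of_neg hm] at hR; constructor <;> nlinarith

omit [NeZero N'] in
/-- If the smoothed cutoff of the image of `I_{m_e}` does not vanish at `y`, then `y` is the
image of a point of `(m_e ρ - q, (m_e+1) ρ + q)`. [folklore] -/
theorem exists_intCast_of_apSmooth_ne_zero {ρ q : ℕ} {a : ℤ} {y : ZMod N'}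
    (h : apSmooth (zmodInd N' (gridIco ρ a)) 1 q y ≠ 0) :
    ∃ x ∈ Finset.Ioo (a * ρ - q) ((a + 1) * ρ + q), (x : ZMod N') = y := by
  unfold apSmooth at h
  obtain ⟨jj, _, hjj⟩ := Finset.exists_ne_zero_of_expect_ne_zero h
  unfold zmodInd apPoint at hjj
  split_ifs at hjj with hmem
  · obtain ⟨z, hz, hzy⟩ := Finset.mem_image.mp hmem
    unfold gridIco at hz
    have hz' := Finset.mem_Ico.mp hz
    have h1 : ((jj.1 : ℕ) : ℤ) < q := by exact_mod_cast jj.1.2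
    have h2 : ((jj.2 : ℕ) : ℤ) < q := by exact_mod_cast jj.2.2
    refine ⟨z + jj.1 - jj.2, Finset.mem_Ioo.mpr ⟨by omega, by omega⟩, ?_⟩
    push_cast
    rw [hzy]; ring
  · exact absurd rfl hjj

/-- **Transfer of a mollified box sum to `ℤ_{N'}^d`**: for an admissible cell `m`
(`(|m_e|+1)ρ + q ≤ R`, `3R + q < N'`),
`∑_{x ∈ supp Φ_m} Φ_m(x) G(x mod N') = ∑_{y ∈ ℤ_{N'}^d} Φ̃_m(y) G(y)` — the reductions of the
support box are exactly the support of `Φ̃_m`, and `Φ̃_m(x mod N') = Φ_m(x)` there.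
[cite: GreenTao2010, App. C ("We embed `[N]` inside `ℤ_{N'}` in the usual manner")] -/
theorem sum_boxCut_eq_sum_boxCutZ {ρ q : ℕ} {m : Fin (n + 1) → ℤ} {R : ℤ}
    (hR : ∀ e, (|m e| + 1) * ρ + q ≤ R) (hN : 3 * R + q < N')
    (G : (Fin (n + 1) → ZMod N') → ℝ) :
    ∑ x ∈ suppBox ρ q m, boxCut ρ q m x * G (fun e => (x e : ZMod N')) =
      ∑ y : Fin (n + 1) → ZMod N', boxCutZ N' ρ q m y * G y := by
  classical
  have hq0 : (0 : ℤ) ≤ q := by positivity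
  -- the reduction is injective on the support box
  have hinj : Set.InjOn (fun (x : Fin (n + 1) → ℤ) (e : Fin (n + 1)) => (x e : ZMod N'))
      (suppBox ρ q m : Set (Fin (n + 1) → ℤ)) := by
    intro x hx x' hx' hxx'
    funext e
    have h1 := abs_le_of_mem_suppBox (Finset.mem_coe.mp hx) hR e
    have h2 := abs_le_of_mem_suppBox (Finset.mem_coe.mp hx') hR e
    refine int_eq_of_zmod_eq (N' := N') (congr_fun hxx' e) ?_
    rw [abs_le] at h1 h2; rw [abs_lt]; constructor <;> omega
  -- the cutoffs agree at reductions of the support box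
  have hagree : ∀ x ∈ suppBox ρ q m, boxCutZ N' ρ q m (fun e => (x e : ZMod N')) = boxCut ρ q m x := by
    intro x hx
    unfold boxCutZ boxCut
    refine Fintype.prod_congr _ _ fun e => ?_
    exact apSmooth_zmodInd_intCast (fun z hz => abs_le_of_mem_gridIco hR e hz)
      (abs_le_of_mem_suppBox hx hR e) hN
  symm
  rw [← Finset.sum_subset (Finset.subset_univ ((suppBox ρ q m).image
    fun (x : Fin (n + 1) → ℤ) (e : Fin (n + 1)) => (x e : ZMod N')))]
  · rw [Finset.sum_image hinj]
    exact Finset.sum_congr rfl fun x hx => by rw [hagree x hx]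
  · -- the cutoff vanishes off the image of the support box
    intro y _ hy
    by_contra hne
    apply hy
    have hall : ∀ e, apSmooth (zmodInd N' (gridIco ρ (m e))) 1 q (y e) ≠ 0 := fun e h0 =>
      hne (by unfold boxCutZ; rw [Finset.prod_eq_zero (Finset.mem_univ e) h0, zero_mul])
    choose x hx hxy using fun e => exists_intCast_of_apSmooth_ne_zero (hall e)
    exact Finset.mem_image.mpr ⟨x, Fintype.mem_piFinset.mpr hx, funext hxy⟩

/-- The average of `Φ̃_m` is `(ρ/N')^d` for an admissible cell. [folklore] -/
theorem expect_boxCutZ {ρ q : ℕ} (hq : 0 < q) {m : Fin (n + 1) → ℤ} {R : ℤ}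
    (hR : ∀ e, (|m e| + 1) * ρ + q ≤ R) (hN : 2 * R < N') :
    𝔼 y : Fin (n + 1) → ZMod N', boxCutZ N' ρ q m y = ((ρ : ℝ) / N') ^ (n + 1) := by
  unfold boxCutZ
  rw [expect_prod_coord]
  have : ∀ e, 𝔼 y : ZMod N', apSmooth (zmodInd N' (gridIco ρ (m e))) 1 q y = (ρ : ℝ) / N' := by
    intro e
    rw [expect_apSmooth _ _ hq, expect_zmodInd (fun z hz => abs_le_of_mem_gridIco hR e hz) hN]
    unfold gridIco
    rw [Int.card_Ico]
    congr 1
    have : (m e + 1) * (ρ : ℤ) - m e * ρ = ρ := by ring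
    rw [this, Int.toNat_natCast]
  simp_rw [this]
  rw [Finset.prod_const, Finset.card_univ, Fintype.card_fin]

end transfer

/-! ### The cells of the decomposition: interior, boundary and exterior -/

section cells

open LatticePointsConvexBody

variable {n t : ℕ} {N' : ℕ} [NeZero N']

/-- Lattice points of `K ⊆ [-N,N]^d` lie in the lattice box. [folklore] -/
theorem mem_latticeBox_of_mem_realBox {N : ℕ} {x : Fin (n + 1) → ℤ}
    (hx : realPoint x ∈ realBox (n + 1) (N : ℝ)) : x ∈ latticeBox (n + 1) N := by
  refine Fintype.mem_piFinset.mpr fun e => Finset.mem_Icc.mpr ?_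
  have h1 : (-(N : ℝ)) ≤ (x e : ℝ) := hx.1 e
  have h2 : (x e : ℝ) ≤ N := hx.2 e
  exact ⟨by exact_mod_cast h1, by exact_mod_cast h2⟩

/-- The value of a form at a lattice point of `K` lies in `[1, N]` when `Ψ(K) ⊆ [1,N]^t`.
[cite: GreenTao2010, Prop. 7.1 (hypothesis `Ψ(K) ⊆ [N]^t`)] -/
theorem eval_mem_of_realPoint_mem {d : ℕ} {Ψ : Fin t → AffLinForm d} {K : Set (Fin d → ℝ)} {N : ℕ}
    (hΨK : ∀ x ∈ K, ∀ i, 1 ≤ (Ψ i).realEval x ∧ (Ψ i).realEval x ≤ N) {x : Fin d → ℤ}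
    (hx : realPoint x ∈ K) (i : Fin t) : 1 ≤ (Ψ i).eval x ∧ (Ψ i).eval x ≤ N := by
  have := hΨK _ hx i
  rw [realEval_realPoint] at this
  exact ⟨by exact_mod_cast this.1, by exact_mod_cast this.2⟩

/-- The extension by zero is dominated by the measure on all of `ℤ_{N'}` when `f` is dominated
on `[N]`. [folklore] -/
theorem abs_extendByZero_le_measure {N : ℕ} {f : ℤ → ℝ} {ν : ZMod N' → ℝ} (hν : ∀ y, 0 ≤ ν y)
    (hf : ∀ x : ℤ, 1 ≤ x → x ≤ N → |f x| ≤ ν (x : ZMod N')) (y : ZMod N') :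
    |extendByZero N' N f y| ≤ ν y := by
  unfold extendByZero
  split_ifs with h
  · have := hf (y.val : ℤ) (by exact_mod_cast h.1) (by exact_mod_cast h.2)
    rwa [Int.cast_natCast, ZMod.natCast_zmod_val] at this
  · rw [abs_zero]; exact hν y

variable {s : ℕ} {N : ℕ} {Ψ : Fin t → AffLinForm (n + 1)} {K : Set (Fin (n + 1) → ℝ)}
  {f : Fin t → ℤ → ℝ} {ν : ZMod N' → ℝ}

open Classical in
/-- **Interior cells**: if the cell box lies inside `K`, the mollified sum over the cell is a
mollified multilinear average over `ℤ_{N'}^d` of the extensions by zero, bounded by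
`N'^d boxErr`. [cite: GreenTao2010, App. C (Proposition 7.1′ and 7.1″)] -/
theorem interiorCell_bound (hs : 1 ≤ s) (hnd : IsNondegenerateSystem Ψ) (hnf : IsNormalForm s Ψ)
    (j₀ : Fin t) {L : ℕ} (hL1 : 1 ≤ L) (hsize : affLinSize Ψ N ≤ L) (hp : N'.Prime) (hLN : L < N')
    (hNN' : N < N') {D₀ : ℕ} {η : ℝ} (hη : 0 ≤ η) (hη1 : η ≤ 1 / 8) (hν : ∀ y, 0 ≤ ν y)
    (hLFC : LinearFormsCondition D₀ D₀ D₀ η ν) (hD : boxDegree s t (n + 1) L ≤ D₀)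
    (hf : ∀ i, ∀ x : ℤ, 1 ≤ x → x ≤ N → |f i x| ≤ ν (x : ZMod N'))
    (hKN : K ⊆ realBox (n + 1) N)
    (hΨK : ∀ x ∈ K, ∀ i, 1 ≤ (Ψ i).realEval x ∧ (Ψ i).realEval x ≤ N)
    {δ₁ : ℝ} (hδ : 0 ≤ δ₁)
    (hgow : gowersPower (s + 1) (extendByZero N' N (f j₀)) ≤ δ₁ ^ 2 ^ (s + 1))
    {ρ q : ℕ} (hq : 1 ≤ q) (hqN : q ≤ N') {m : Fin (n + 1) → ℤ} {R : ℤ}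
    (hR : ∀ e, (|m e| + 1) * ρ + q ≤ R) (hRN : 3 * R + q < N') (hmK : cellBox ρ q m ⊆ K) :
    |∑ x ∈ (latticeBox (n + 1) N).filter (fun x => realPoint x ∈ K),
        boxCut ρ q m x * ∏ i, f i ((Ψ i).eval x)| ≤
      (N' : ℝ) ^ (n + 1) * boxErr s η δ₁ ((N' : ℝ) / q) := by
  set F : (Fin (n + 1) → ℤ) → ℝ := fun x => ∏ i, f i ((Ψ i).eval x) with hF
  set G : (Fin (n + 1) → ZMod N') → ℝ := fun y => ∏ i, extendByZero N' N (f i) ((Ψ i).modEval N' y)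
    with hG
  -- Step 1: restrict to the support box
  have hsupp : suppBox ρ q m ⊆ (latticeBox (n + 1) N).filter (fun x => realPoint x ∈ K) := by
    intro x hx
    have hxK : realPoint x ∈ K := hmK (realPoint_mem_cellBox hx)
    exact Finset.mem_filter.mpr ⟨mem_latticeBox_of_mem_realBox (hKN hxK), hxK⟩
  have hS1 : ∑ x ∈ (latticeBox (n + 1) N).filter (fun x => realPoint x ∈ K), boxCut ρ q m x * F x =
      ∑ x ∈ suppBox ρ q m, boxCut ρ q m x * F x := by
    symm
    refine Finset.sum_subset hsupp fun x _ hx => ?_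
    have : boxCut ρ q m x = 0 := by
      by_contra h; exact hx (mem_suppBox_of_boxCut_ne_zero h)
    rw [this, zero_mul]
  -- Step 2: the integrand through the reduction
  have hS2 : ∀ x ∈ suppBox ρ q m, F x = G (fun e => (x e : ZMod N')) := by
    intro x hx
    simp only [hF, hG]
    refine Fintype.prod_congr _ _ fun i => ?_
    have hxK : realPoint x ∈ K := hmK (realPoint_mem_cellBox hx)
    obtain ⟨h1, h2⟩ := eval_mem_of_realPoint_mem hΨK hxK i
    rw [← AffLinForm.intCast_eval, extendByZero_intCast hNN' (f i) h1 h2]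
  -- Step 3: transfer and average
  rw [hS1, Finset.sum_congr rfl fun x hx => by rw [hS2 x hx], sum_boxCut_eq_sum_boxCutZ hR hRN G]
  have hcard : (Fintype.card (Fin (n + 1) → ZMod N') : ℝ) = (N' : ℝ) ^ (n + 1) := by
    rw [Fintype.card_fun, ZMod.card, Fintype.card_fin]; push_cast; ring
  have havg : ∑ y : Fin (n + 1) → ZMod N', boxCutZ N' ρ q m y * G y =
      (N' : ℝ) ^ (n + 1) * 𝔼 y : Fin (n + 1) → ZMod N', G y * boxCutZ N' ρ q m y := by
    have hN0 : (N' : ℝ) ^ (n + 1) ≠ 0 := pow_ne_zero _ (by exact_mod_cast NeZero.ne N')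
    rw [Fintype.expect_eq_sum_div_card, hcard, mul_div_cancel₀ _ hN0]
    exact Finset.sum_congr rfl fun y _ => mul_comm _ _
  rw [havg, abs_mul, abs_of_nonneg (by positivity)]
  refine mul_le_mul_of_nonneg_left ?_ (by positivity)
  -- Step 4: the mollified multilinear average bound
  exact box_bound (N' := N') hs hnd hnf j₀ hL1 hsize hp hLN (by omega) hη hη1 hν hLFC hD
    (fun i y => abs_extendByZero_le_measure hν (hf i) y) hδ hgow
    (fun e y => abs_zmodInd_le _ _) hq hqN

end cells

section cells2

open LatticePointsConvexBody

variable {n t : ℕ} {N' : ℕ} [NeZero N']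
variable {s : ℕ} {N : ℕ} {Ψ : Fin t → AffLinForm (n + 1)} {K : Set (Fin (n + 1) → ℝ)}
  {f : Fin t → ℤ → ℝ} {ν : ZMod N' → ℝ}

/-- `boxDegree` is monotone in the number of forms. [folklore] -/
theorem boxDegree_mono_t {s t t' d L : ℕ} (h : t' ≤ t) : boxDegree s t' d L ≤ boxDegree s t d L := by
  unfold boxDegree coreDegree
  have : 2 ^ (s + 1) * 2 ^ (s + 1) * t' ≤ 2 ^ (s + 1) * 2 ^ (s + 1) * t := Nat.mul_le_mul_left _ h
  omega

/-- The Gowers bound for `ν♯ - 1 = (ν - 1)/2`: `‖ν♯ - 1‖_{U^{s+1}}^{2^{s+1}} ≤ (2 η^{1/2^{s+1}})^{2^{s+1}}`.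
[cite: GreenTao2010, App. C ("`‖ν - 1‖_{U^{s+1}(ℤ_{N'})} = o(1)`")] -/
theorem gowersPower_half_sub_le {D₀ : ℕ} {η : ℝ} (hLFC : LinearFormsCondition D₀ D₀ D₀ η ν)
    (hη : 0 ≤ η) (hD : 2 ^ (s + 1) ≤ D₀) (hD' : s + 2 ≤ D₀) :
    gowersPower (s + 1) (fun z => (ν z - 1) / 2) ≤
      (2 * η ^ ((2 ^ (s + 1) : ℕ) : ℝ)⁻¹) ^ 2 ^ (s + 1) := by
  have hfun : (fun z => (ν z - 1) / 2) = fun z => nuSharp ν z - 1 := funext fun z => by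
    rw [nuSharp_sub_one]
  rw [hfun, mul_pow, Real.rpow_inv_natCast_pow hη (by positivity)]
  have h := abs_gowersPower_sub_one_le (linearFormsCondition_nuSharp hLFC hη) hη hD (by omega)
    (by omega)
  exact (le_abs_self _).trans h

open Classical in
/-- **Arbitrary cells, by the majorant**: the mollified sum over any admissible cell is at most
`ρ^d + N'^d 3^t boxErr(δ₂)` with `δ₂ = 2η^{1/2^{s+1}}`: dominate `|f_i| ≤ ν`, transfer to
`ℤ_{N'}^d`, expand `ν = 1 + 2 · (ν-1)/2` and bound each of the `3^t - 1` non-trivial terms by the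
mollified multilinear average bound for the corresponding subsystem with majorant `ν♯`.
[cite: GreenTao2010, App. C (the estimate for `𝔼 G_ε ∏ ν(ψ_i)`: "writing `ν = 1 + (ν-1)` and
expanding as a sum of `2^t` terms")] -/
theorem cell_bound_majorant (hs : 1 ≤ s) (hnd : IsNondegenerateSystem Ψ) (hnf : IsNormalForm s Ψ)
    {L : ℕ} (hL1 : 1 ≤ L) (hsize : affLinSize Ψ N ≤ L) (hp : N'.Prime) (hLN : L < N')
    {D₀ : ℕ} {η : ℝ} (hη : 0 ≤ η) (hη1 : η ≤ 1 / 8) (hν : ∀ y, 0 ≤ ν y)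
    (hLFC : LinearFormsCondition D₀ D₀ D₀ η ν) (hD : boxDegree s t (n + 1) L ≤ D₀)
    (hf : ∀ i, ∀ x : ℤ, 1 ≤ x → x ≤ N → |f i x| ≤ ν (x : ZMod N'))
    (hΨK : ∀ x ∈ K, ∀ i, 1 ≤ (Ψ i).realEval x ∧ (Ψ i).realEval x ≤ N)
    {ρ q : ℕ} (hq : 1 ≤ q) (hqN : q ≤ N') {m : Fin (n + 1) → ℤ} {R : ℤ}
    (hR : ∀ e, (|m e| + 1) * ρ + q ≤ R) (hRN : 3 * R + q < N') :
    |∑ x ∈ (latticeBox (n + 1) N).filter (fun x => realPoint x ∈ K),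
        boxCut ρ q m x * ∏ i, f i ((Ψ i).eval x)| ≤
      (ρ : ℝ) ^ (n + 1) + (N' : ℝ) ^ (n + 1) * (3 ^ t *
        boxErr s η (2 * η ^ ((2 ^ (s + 1) : ℕ) : ℝ)⁻¹) ((N' : ℝ) / q)) := by
  set A := (latticeBox (n + 1) N).filter (fun x => realPoint x ∈ K) with hA
  set H : (Fin (n + 1) → ℤ) → ℝ := fun x => ∏ i, ν (((Ψ i).eval x : ℤ) : ZMod N') with hH
  set G : (Fin (n + 1) → ZMod N') → ℝ := fun y => ∏ i, ν ((Ψ i).modEval N' y) with hG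
  have hHnn : ∀ x, 0 ≤ H x := fun x => Finset.prod_nonneg fun _ _ => hν _
  -- B1: dominate and pass to the support box
  have hB1 : |∑ x ∈ A, boxCut ρ q m x * ∏ i, f i ((Ψ i).eval x)| ≤
      ∑ x ∈ suppBox ρ q m, boxCut ρ q m x * H x := by
    refine (Finset.abs_sum_le_sum_abs _ _).trans ?_
    have h1 : ∀ x ∈ A, |boxCut ρ q m x * ∏ i, f i ((Ψ i).eval x)| ≤ boxCut ρ q m x * H x := by
      intro x hx
      rw [abs_mul, abs_of_nonneg (boxCut_nonneg ρ q m x), Finset.abs_prod]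
      refine mul_le_mul_of_nonneg_left (Finset.prod_le_prod (fun _ _ => abs_nonneg _) fun i _ => ?_)
        (boxCut_nonneg ρ q m x)
      obtain ⟨h1, h2⟩ := eval_mem_of_realPoint_mem hΨK (Finset.mem_filter.mp hx).2 i
      exact hf i _ h1 h2
    refine (Finset.sum_le_sum h1).trans ?_
    rw [← Finset.sum_filter_add_sum_filter_not A (fun x => x ∈ suppBox ρ q m)]
    have hz : ∑ x ∈ A.filter (fun x => ¬ x ∈ suppBox ρ q m), boxCut ρ q m x * H x = 0 :=
      Finset.sum_eq_zero fun x hx => by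
        have : boxCut ρ q m x = 0 := by
          by_contra h; exact (Finset.mem_filter.mp hx).2 (mem_suppBox_of_boxCut_ne_zero h)
        rw [this, zero_mul]
    rw [hz, add_zero]
    exact Finset.sum_le_sum_of_subset_of_nonneg (fun x hx => (Finset.mem_filter.mp hx).2)
      fun x _ _ => mul_nonneg (boxCut_nonneg ρ q m x) (hHnn x)
  refine hB1.trans ?_
  -- B2: transfer
  have hS2 : ∀ x, H x = G (fun e => (x e : ZMod N')) := fun x => by
    simp only [hH, hG]
    exact Fintype.prod_congr _ _ fun i => by rw [← AffLinForm.intCast_eval]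
  simp_rw [hS2]
  rw [sum_boxCut_eq_sum_boxCutZ hR hRN G]
  have hcard : (Fintype.card (Fin (n + 1) → ZMod N') : ℝ) = (N' : ℝ) ^ (n + 1) := by
    rw [Fintype.card_fun, ZMod.card, Fintype.card_fin]; push_cast; ring
  have hN0 : (N' : ℝ) ^ (n + 1) ≠ 0 := pow_ne_zero _ (by exact_mod_cast NeZero.ne N')
  have havg : ∑ y : Fin (n + 1) → ZMod N', boxCutZ N' ρ q m y * G y =
      (N' : ℝ) ^ (n + 1) * 𝔼 y : Fin (n + 1) → ZMod N', boxCutZ N' ρ q m y * G y := by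
    rw [Fintype.expect_eq_sum_div_card, hcard, mul_div_cancel₀ _ hN0]
  rw [havg]
  -- B3: expand `ν = 1 + 2 g`
  set g : ZMod N' → ℝ := fun z => (ν z - 1) / 2 with hg
  have hexp : ∀ y, G y = ∑ T : Finset (Fin t), 2 ^ T.card * ∏ i ∈ T, g ((Ψ i).modEval N' y) := by
    intro y
    simp only [hG]
    have : ∀ i, ν ((Ψ i).modEval N' y) = 2 * g ((Ψ i).modEval N' y) + 1 := fun i => by
      simp only [hg]; ring
    simp_rw [this]
    rw [Fintype.prod_add]
    refine Fintype.sum_congr _ _ fun T => ?_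
    rw [Finset.prod_const_one, mul_one, Finset.prod_mul_distrib, Finset.prod_const]
  simp_rw [hexp, Finset.mul_sum]
  rw [Finset.expect_sum_comm]
  -- B4: bound each term
  have hδ₂ : 0 ≤ 2 * η ^ ((2 ^ (s + 1) : ℕ) : ℝ)⁻¹ := by positivity
  have hDs : 2 ^ (s + 1) ≤ D₀ ∧ s + 2 ≤ D₀ := by
    unfold boxDegree coreDegree at hD
    generalize hAg : 2 ^ (s + 1) = A at hD ⊢
    generalize hBg : A * A * t = B at hD
    generalize hCg : L ^ 2 = C at hD
    constructor <;> omega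
  have hgow := gowersPower_half_sub_le (s := s) hLFC hη hDs.1 hDs.2
  have hterm : ∀ T : Finset (Fin t), |𝔼 y : Fin (n + 1) → ZMod N',
      boxCutZ N' ρ q m y * (2 ^ T.card * ∏ i ∈ T, g ((Ψ i).modEval N' y))| ≤
      if T = ∅ then ((ρ : ℝ) / N') ^ (n + 1) else
        2 ^ T.card * boxErr s η (2 * η ^ ((2 ^ (s + 1) : ℕ) : ℝ)⁻¹) ((N' : ℝ) / q) := by
    intro T
    rcases T.eq_empty_or_nonempty with rfl | hne
    · simp only [Finset.card_empty, pow_zero, Finset.prod_empty, mul_one, if_true]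
      rw [expect_boxCutZ hq hR (by omega), abs_of_nonneg (by positivity)]
    · rw [if_neg hne.ne_empty]
      -- the subsystem indexed by `T`
      let e : Fin T.card ≃ T := (finCongr (Fintype.card_coe T).symm).trans (Fintype.equivFin T).symm
      have hinj : Function.Injective (fun i : Fin T.card => (e i).1) :=
        fun i j hij => e.injective (Subtype.ext hij)
      have hprod : ∀ y : Fin (n + 1) → ZMod N', ∏ i ∈ T, g ((Ψ i).modEval N' y) =
          ∏ i' : Fin T.card, g (((Ψ ∘ fun i => (e i).1) i').modEval N' y) := fun y => by
        rw [← Finset.prod_coe_sort T, ← Fintype.prod_equiv e]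
        intro i; rfl
      have hrw : (𝔼 y : Fin (n + 1) → ZMod N',
          boxCutZ N' ρ q m y * (2 ^ T.card * ∏ i ∈ T, g ((Ψ i).modEval N' y))) =
          2 ^ T.card * 𝔼 y : Fin (n + 1) → ZMod N',
            (∏ i' : Fin T.card, g (((Ψ ∘ fun i => (e i).1) i').modEval N' y)) *
              ∏ e', apSmooth (zmodInd N' (gridIco ρ (m e'))) 1 q (y e') := by
        rw [Finset.mul_expect]
        refine Finset.expect_congr rfl fun y _ => ?_
        rw [hprod y]; unfold boxCutZ; ring
      rw [hrw, abs_mul, abs_of_nonneg (by positivity)]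
      refine mul_le_mul_of_nonneg_left ?_ (by positivity)
      have hTt : T.card ≤ t := (Finset.card_le_univ T).trans (by rw [Fintype.card_fin])
      exact box_bound (N' := N') hs (hnd.comp_of_injective hinj) (hnf.comp_of_injective hinj)
        ⟨0, hne.card_pos⟩ hL1 ((affLinSize_comp_le Ψ hinj (N : ℝ)).trans hsize) hp hLN (by omega)
        hη hη1 (nuSharp_nonneg hν) (linearFormsCondition_nuSharp hLFC hη)
        ((boxDegree_mono_t hTt).trans hD) (fun _ z => abs_half_sub_le_nuSharp hν z) hδ₂ hgow
        (fun e' y => abs_zmodInd_le _ _) hq hqN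
  -- sum up
  have hsum : |∑ T : Finset (Fin t), 𝔼 y : Fin (n + 1) → ZMod N',
      boxCutZ N' ρ q m y * (2 ^ T.card * ∏ i ∈ T, g ((Ψ i).modEval N' y))| ≤
      ((ρ : ℝ) / N') ^ (n + 1) + 3 ^ t * boxErr s η (2 * η ^ ((2 ^ (s + 1) : ℕ) : ℝ)⁻¹) ((N' : ℝ) / q) := by
    refine (Finset.abs_sum_le_sum_abs _ _).trans ((Finset.sum_le_sum fun T _ => hterm T).trans ?_)
    rw [← Finset.add_sum_erase _ _ (Finset.mem_univ (∅ : Finset (Fin t))), if_pos rfl]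
    refine add_le_add le_rfl ?_
    have hbe : 0 ≤ boxErr s η (2 * η ^ ((2 ^ (s + 1) : ℕ) : ℝ)⁻¹) ((N' : ℝ) / q) :=
      boxErr_nonneg s hη hδ₂ (by positivity)
    calc ∑ T ∈ Finset.univ.erase (∅ : Finset (Fin t)),
          (if T = ∅ then ((ρ : ℝ) / N') ^ (n + 1) else
            2 ^ T.card * boxErr s η (2 * η ^ ((2 ^ (s + 1) : ℕ) : ℝ)⁻¹) ((N' : ℝ) / q))
        = ∑ T ∈ Finset.univ.erase (∅ : Finset (Fin t)),
            2 ^ T.card * boxErr s η (2 * η ^ ((2 ^ (s + 1) : ℕ) : ℝ)⁻¹) ((N' : ℝ) / q) :=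
          Finset.sum_congr rfl fun T hT => if_neg (Finset.ne_of_mem_erase hT)
      _ ≤ ∑ T : Finset (Fin t), 2 ^ T.card * boxErr s η (2 * η ^ ((2 ^ (s + 1) : ℕ) : ℝ)⁻¹) ((N' : ℝ) / q) :=
          Finset.sum_le_sum_of_subset_of_nonneg (Finset.erase_subset _ _) fun T _ _ => by positivity
      _ = 3 ^ t * boxErr s η (2 * η ^ ((2 ^ (s + 1) : ℕ) : ℝ)⁻¹) ((N' : ℝ) / q) := by
          rw [← Finset.sum_mul]
          congr 1
          have := Finset.sum_pow_mul_eq_add_pow (2 : ℝ) 1 (Finset.univ : Finset (Fin t))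
          simp only [one_pow, mul_one, Finset.card_univ, Fintype.card_fin] at this
          rw [← Finset.powerset_univ, this]; norm_num
  calc (N' : ℝ) ^ (n + 1) * ∑ T : Finset (Fin t), 𝔼 y : Fin (n + 1) → ZMod N',
        boxCutZ N' ρ q m y * (2 ^ T.card * ∏ i ∈ T, g ((Ψ i).modEval N' y))
      ≤ (N' : ℝ) ^ (n + 1) * (((ρ : ℝ) / N') ^ (n + 1) +
          3 ^ t * boxErr s η (2 * η ^ ((2 ^ (s + 1) : ℕ) : ℝ)⁻¹) ((N' : ℝ) / q)) :=
        mul_le_mul_of_nonneg_left ((le_abs_self _).trans hsum) (by positivity)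
    _ = _ := by
        rw [mul_add, div_pow, mul_div_cancel₀ _ hN0]

open Classical in
/-- **Exterior cells** contribute nothing. [folklore] -/
theorem exteriorCell_eq_zero {ρ q : ℕ} {m : Fin (n + 1) → ℤ} (h : cellBox ρ q m ∩ K = ∅)
    (F : (Fin (n + 1) → ℤ) → ℝ) :
    ∑ x ∈ (latticeBox (n + 1) N).filter (fun x => realPoint x ∈ K), boxCut ρ q m x * F x = 0 := by
  refine Finset.sum_eq_zero fun x hx => ?_
  have : boxCut ρ q m x = 0 := by
    by_contra hne
    have h1 := realPoint_mem_cellBox (mem_suppBox_of_boxCut_ne_zero hne)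
    have h2 := (Finset.mem_filter.mp hx).2
    have : realPoint x ∈ cellBox ρ q m ∩ K := ⟨h1, h2⟩
    rw [h] at this; exact this
  rw [this, zero_mul]

open Classical in
/-- **The decomposition**: `∑_{K ∩ ℤ^d} F = ∑_m ∑_{K ∩ ℤ^d} Φ_m F` over the grid range (partition
of unity). [folklore] -/
theorem sum_eq_sum_cells {ρ q : ℕ} (hρ : 0 < ρ) (hq : 0 < q) (F : (Fin (n + 1) → ℤ) → ℝ) :
    ∑ x ∈ (latticeBox (n + 1) N).filter (fun x => realPoint x ∈ K), F x =
      ∑ m ∈ Fintype.piFinset (fun _ : Fin (n + 1) => gridRange N ρ q),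
        ∑ x ∈ (latticeBox (n + 1) N).filter (fun x => realPoint x ∈ K), boxCut ρ q m x * F x := by
  rw [Finset.sum_comm]
  refine Finset.sum_congr rfl fun x hx => ?_
  rw [← Finset.sum_mul]
  have hxN : ∀ e, |x e| ≤ N := fun e => by
    have := Finset.mem_Icc.mp (Fintype.mem_piFinset.mp (Finset.mem_filter.mp hx).1 e)
    exact abs_le.mpr this
  have hone : ∑ m ∈ Fintype.piFinset (fun _ : Fin (n + 1) => gridRange N ρ q), boxCut ρ q m x = 1 := by
    unfold boxCut
    rw [← Finset.prod_univ_sum (fun _ : Fin (n + 1) => gridRange N ρ q)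
      (fun e a => trapZ (gridIco ρ a) q (x e))]
    refine Finset.prod_eq_one fun e _ => ?_
    exact sum_trapZ_gridIco hρ hq (x e) _ fun jj => div_mem_gridRange hρ (hxN e) jj
  rw [hone, one_mul]

end cells2

section combine

open LatticePointsConvexBody

variable {n t : ℕ} {N' : ℕ} [NeZero N']
variable {s : ℕ} {N : ℕ} {Ψ : Fin t → AffLinForm (n + 1)} {K : Set (Fin (n + 1) → ℝ)}
  {f : Fin t → ℤ → ℝ} {ν : ZMod N' → ℝ}

/-- `boxErr` is monotone in the smoothing ratio. [folklore] -/
theorem boxErr_mono_R (s : ℕ) {η δ₁ R R' : ℝ} (hδ : 0 ≤ δ₁) (hR : 0 ≤ R) (hRR' : R ≤ R') :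
    boxErr s η δ₁ R ≤ boxErr s η δ₁ R' := by
  unfold boxErr
  have : R ^ (1 / 4 : ℝ) ≤ R' ^ (1 / 4 : ℝ) := Real.rpow_le_rpow hR hRR' (by norm_num)
  nlinarith

open Classical in
/-- **The combined estimate**: decomposing into cells and applying the interior bound to every
cell and the majorant bound to the boundary cells,
`|∑_{K∩ℤ^d} ∏ f_i(ψ_i)| ≤ #cells · N'^d boxErr(δ₁) + #boundary cells · (ρ^d + N'^d 3^t boxErr(δ₂))`.
[cite: GreenTao2010, App. C (Removing the convex cutoff: `1_{K'} = F_ε + O(G_ε)`, the bound for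
`𝔼 F_ε ∏ f_i(ψ_i)` from Proposition 7.1″ and the bound for `𝔼 G_ε ∏ ν(ψ_i)`)] -/
theorem sum_cells_estimate (hs : 1 ≤ s) (hnd : IsNondegenerateSystem Ψ) (hnf : IsNormalForm s Ψ)
    (j₀ : Fin t) {L : ℕ} (hL1 : 1 ≤ L) (hsize : affLinSize Ψ N ≤ L) (hp : N'.Prime) (hLN : L < N')
    (hNN' : N < N') {D₀ : ℕ} {η : ℝ} (hη : 0 ≤ η) (hη1 : η ≤ 1 / 8) (hν : ∀ y, 0 ≤ ν y)
    (hLFC : LinearFormsCondition D₀ D₀ D₀ η ν) (hD : boxDegree s t (n + 1) L ≤ D₀)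
    (hf : ∀ i, ∀ x : ℤ, 1 ≤ x → x ≤ N → |f i x| ≤ ν (x : ZMod N'))
    (hKN : K ⊆ realBox (n + 1) N)
    (hΨK : ∀ x ∈ K, ∀ i, 1 ≤ (Ψ i).realEval x ∧ (Ψ i).realEval x ≤ N)
    {δ₁ : ℝ} (hδ : 0 ≤ δ₁)
    (hgow : gowersPower (s + 1) (extendByZero N' N (f j₀)) ≤ δ₁ ^ 2 ^ (s + 1))
    {ρ q : ℕ} (hρ : 1 ≤ ρ) (hq : 1 ≤ q) (hqN : q ≤ N') {R : ℤ}
    (hR : ∀ m ∈ Fintype.piFinset (fun _ : Fin (n + 1) => gridRange N ρ q), ∀ e, (|m e| + 1) * ρ + q ≤ R)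
    (hRN : 3 * R + q < N') :
    |∑ x ∈ (latticeBox (n + 1) N).filter (fun x => realPoint x ∈ K), ∏ i, f i ((Ψ i).eval x)| ≤
      ((Fintype.piFinset (fun _ : Fin (n + 1) => gridRange N ρ q)).card : ℝ) *
          ((N' : ℝ) ^ (n + 1) * boxErr s η δ₁ ((N' : ℝ) / q)) +
        (((Fintype.piFinset (fun _ : Fin (n + 1) => gridRange N ρ q)).filter fun m =>
            (cellBox ρ q m ∩ K).Nonempty ∧ ¬ cellBox ρ q m ⊆ K).card : ℝ) *
          ((ρ : ℝ) ^ (n + 1) + (N' : ℝ) ^ (n + 1) *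
            (3 ^ t * boxErr s η (2 * η ^ ((2 ^ (s + 1) : ℕ) : ℝ)⁻¹) ((N' : ℝ) / q))) := by
  set Ms := Fintype.piFinset (fun _ : Fin (n + 1) => gridRange N ρ q) with hMs
  set A := (latticeBox (n + 1) N).filter (fun x => realPoint x ∈ K) with hA
  set IB : ℝ := (N' : ℝ) ^ (n + 1) * boxErr s η δ₁ ((N' : ℝ) / q) with hIB
  set BB : ℝ := (ρ : ℝ) ^ (n + 1) + (N' : ℝ) ^ (n + 1) *
    (3 ^ t * boxErr s η (2 * η ^ ((2 ^ (s + 1) : ℕ) : ℝ)⁻¹) ((N' : ℝ) / q)) with hBB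
  have hIB0 : 0 ≤ IB := mul_nonneg (by positivity) (boxErr_nonneg s hη hδ (by positivity))
  have hBB0 : 0 ≤ BB := add_nonneg (by positivity)
    (mul_nonneg (by positivity) (mul_nonneg (by positivity) (boxErr_nonneg s hη (by positivity) (by positivity))))
  rw [sum_eq_sum_cells (K := K) (N := N) hρ hq]
  refine (Finset.abs_sum_le_sum_abs _ _).trans ?_
  have hcell : ∀ m ∈ Ms, |∑ x ∈ A, boxCut ρ q m x * ∏ i, f i ((Ψ i).eval x)| ≤
      IB + if (cellBox ρ q m ∩ K).Nonempty ∧ ¬ cellBox ρ q m ⊆ K then BB else 0 := by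
    intro m hm
    by_cases h1 : cellBox ρ q m ⊆ K
    · have := interiorCell_bound hs hnd hnf j₀ hL1 hsize hp hLN hNN' hη hη1 hν hLFC hD hf hKN hΨK hδ
        hgow hq hqN (hR m hm) hRN h1
      refine this.trans ?_
      split_ifs <;> linarith
    · by_cases h2 : (cellBox ρ q m ∩ K).Nonempty
      · rw [if_pos ⟨h2, h1⟩]
        have := cell_bound_majorant (K := K) hs hnd hnf hL1 hsize hp hLN hη hη1 hν hLFC hD hf hΨK hq hqN
          (hR m hm) hRN
        linarith
      · rw [Set.not_nonempty_iff_eq_empty] at h2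
        rw [exteriorCell_eq_zero h2, abs_zero]
        split_ifs <;> linarith
  refine (Finset.sum_le_sum hcell).trans ?_
  rw [Finset.sum_add_distrib, Finset.sum_const, nsmul_eq_mul, ← Finset.sum_filter, Finset.sum_const,
    nsmul_eq_mul]

/-- The size of the grid range. [folklore] -/
theorem card_gridRange_le {N ρ q : ℕ} (hρ : 1 ≤ ρ) (hqρ : q ≤ ρ) :
    ((gridRange N ρ q).card : ℝ) ≤ 2 * ((N : ℝ) / ρ) + 4 := by
  unfold gridRange
  rw [Int.card_Icc]
  have hρ' : (0 : ℤ) < ρ := by exact_mod_cast hρ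
  have h1 : ((N : ℤ) + q) / ρ ≤ N / ρ + 1 := by
    calc ((N : ℤ) + q) / ρ ≤ ((N : ℤ) + ρ) / ρ := Int.ediv_le_ediv hρ' (by omega)
      _ = N / ρ + 1 := by rw [Int.add_ediv_of_dvd_right (dvd_refl (ρ : ℤ)), Int.ediv_self hρ'.ne']
  have h2 : ((N : ℤ) / ρ : ℤ) ≤ ((N : ℝ) / ρ : ℝ) := by
    have hρr : (0 : ℝ) < ρ := by exact_mod_cast hρ
    rw [le_div_iff₀ hρr]
    have := Int.ediv_mul_le (N : ℤ) hρ'.ne'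
    exact_mod_cast this
  have h3 : (((N : ℤ) + q) / ρ + 1 - (-(((N : ℤ) + q) / ρ) - 1)).toNat ≤ (2 * ((N : ℤ) / ρ) + 4).toNat := by
    apply Int.toNat_le_toNat; omega
  have h4 : ((2 * ((N : ℤ) / ρ) + 4).toNat : ℝ) = 2 * (((N : ℤ) / ρ : ℤ) : ℝ) + 4 := by
    have h0 : 0 ≤ 2 * ((N : ℤ) / ρ) + 4 := by
      have := Int.ediv_nonneg (show (0 : ℤ) ≤ N by positivity) hρ'.le; omega
    have : (((2 * ((N : ℤ) / ρ) + 4).toNat : ℤ) : ℝ) = ((2 * ((N : ℤ) / ρ) + 4 : ℤ) : ℝ) := by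
      rw [Int.toNat_of_nonneg h0]
    rw [Int.cast_natCast] at this
    rw [this]; push_cast; ring
  calc (((((N : ℤ) + q) / ρ + 1 - (-(((N : ℤ) + q) / ρ) - 1)).toNat : ℕ) : ℝ)
      ≤ ((2 * ((N : ℤ) / ρ) + 4).toNat : ℝ) := by exact_mod_cast h3
    _ = 2 * (((N : ℤ) / ρ : ℤ) : ℝ) + 4 := h4
    _ ≤ 2 * ((N : ℝ) / ρ) + 4 := by linarith

/-- Elements of the grid range are at most `N/ρ + 2` in size. [folklore] -/
theorem abs_le_of_mem_gridRange {N ρ q : ℕ} (hρ : 1 ≤ ρ) (hqρ : q ≤ ρ) {a : ℤ}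
    (ha : a ∈ gridRange N ρ q) : |a| ≤ N / ρ + 2 := by
  unfold gridRange at ha
  rw [Finset.mem_Icc] at ha
  have hρ' : (0 : ℤ) < ρ := by exact_mod_cast hρ
  have h1 : ((N : ℤ) + q) / ρ ≤ N / ρ + 1 := by
    calc ((N : ℤ) + q) / ρ ≤ ((N : ℤ) + ρ) / ρ := Int.ediv_le_ediv hρ' (by omega)
      _ = N / ρ + 1 := by rw [Int.add_ediv_of_dvd_right (dvd_refl (ρ : ℤ)), Int.ediv_self hρ'.ne']
  rw [abs_le]; constructor <;> omega

/-- The grid range lies in the lattice box of size `N/ρ + 2`. [folklore] -/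
theorem piFinset_gridRange_subset {N ρ q : ℕ} (hρ : 1 ≤ ρ) (hqρ : q ≤ ρ) :
    Fintype.piFinset (fun _ : Fin (n + 1) => gridRange N ρ q) ⊆ latticeBox (n + 1) (N / ρ + 2) := by
  intro m hm
  refine Fintype.mem_piFinset.mpr fun e => Finset.mem_Icc.mpr ?_
  have := abs_le_of_mem_gridRange hρ hqρ (Fintype.mem_piFinset.mp hm e)
  rw [abs_le] at this
  push_cast
  exact this

/-- Admissibility of the cells of the grid range with `R = N + 4ρ`. [folklore] -/
theorem gridRange_admissible {N ρ q : ℕ} (hρ : 1 ≤ ρ) (hqρ : q ≤ ρ)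
    {m : Fin (n + 1) → ℤ} (hm : m ∈ Fintype.piFinset (fun _ : Fin (n + 1) => gridRange N ρ q))
    (e : Fin (n + 1)) : (|m e| + 1) * ρ + q ≤ (N : ℤ) + 4 * ρ := by
  have h := abs_le_of_mem_gridRange hρ hqρ (Fintype.mem_piFinset.mp hm e)
  have hρ' : (0 : ℤ) < ρ := by exact_mod_cast hρ
  have hdiv := Int.ediv_mul_le (N : ℤ) hρ'.ne'
  have hq' : (q : ℤ) ≤ ρ := by exact_mod_cast hqρ
  nlinarith [abs_nonneg (m e)]

end combine

section final

open LatticePointsConvexBody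

/-- The `η`-part of the error: interior `(8η)^{1/2^{s+2}}`-terms and the boundary majorant terms,
with their multiplicities. [folklore] -/
def etaErr (s t n : ℕ) (Mc Bc C Rm η : ℝ) : ℝ :=
  Mc * (2 * C) ^ (n + 1) * (2 * (8 * η) ^ ((2 ^ (s + 2) : ℕ) : ℝ)⁻¹) +
    Bc * (2 * C) ^ (n + 1) * (3 ^ t *
      (2 * (2 * η ^ ((2 ^ (s + 1) : ℕ) : ℝ)⁻¹ + (8 * η) ^ ((2 ^ (s + 2) : ℕ) : ℝ)⁻¹) +
        2 * (Rm ^ (1 / 4 : ℝ) * (2 * η ^ ((2 ^ (s + 1) : ℕ) : ℝ)⁻¹))))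

/-- `etaErr` is the `η`-part of the combined estimate. [folklore] -/
theorem etaErr_eq (s t n : ℕ) (Mc Bc C Rm η : ℝ) :
    etaErr s t n Mc Bc C Rm η =
      Mc * (2 * C) ^ (n + 1) * (2 * (8 * η) ^ ((2 ^ (s + 2) : ℕ) : ℝ)⁻¹) +
        Bc * (2 * C) ^ (n + 1) * (3 ^ t * boxErr s η (2 * η ^ ((2 ^ (s + 1) : ℕ) : ℝ)⁻¹) Rm) := by
  unfold etaErr boxErr; rfl

/-- `etaErr` is continuous in `η`. [folklore] -/
theorem continuous_etaErr (s t n : ℕ) (Mc Bc C Rm : ℝ) :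
    Continuous fun η : ℝ => etaErr s t n Mc Bc C Rm η := by
  unfold etaErr
  have ha : Continuous fun η : ℝ => (8 * η) ^ ((2 ^ (s + 2) : ℕ) : ℝ)⁻¹ :=
    (Real.continuous_rpow_const (by positivity)).comp (continuous_const.mul continuous_id)
  have hb : Continuous fun η : ℝ => η ^ ((2 ^ (s + 1) : ℕ) : ℝ)⁻¹ :=
    Real.continuous_rpow_const (by positivity)
  fun_prop

/-- `etaErr` vanishes at `η = 0`. [folklore] -/
theorem etaErr_zero (s t n : ℕ) (Mc Bc C Rm : ℝ) : etaErr s t n Mc Bc C Rm 0 = 0 := by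
  unfold etaErr
  have ha : (0 : ℝ) ^ ((2 ^ (s + 2) : ℕ) : ℝ)⁻¹ = 0 := Real.zero_rpow (by positivity)
  have hb : (0 : ℝ) ^ ((2 ^ (s + 1) : ℕ) : ℝ)⁻¹ = 0 := Real.zero_rpow (by positivity)
  rw [mul_zero, ha, hb]; ring

/-- A small `η` making `etaErr ≤ ε/3`, with `η ≤ 1/8`. [folklore] -/
theorem exists_eta (s t n : ℕ) (Mc Bc C Rm : ℝ) {ε : ℝ} (hε : 0 < ε) :
    ∃ η : ℝ, 0 < η ∧ η ≤ 1 / 8 ∧ etaErr s t n Mc Bc C Rm η ≤ ε / 3 := by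
  have hc := (continuous_etaErr s t n Mc Bc C Rm).continuousAt (x := 0)
  have hlt : etaErr s t n Mc Bc C Rm 0 < ε / 3 := by rw [etaErr_zero]; positivity
  obtain ⟨r, hr, h⟩ := Metric.eventually_nhds_iff.mp (hc.eventually_lt continuousAt_const hlt)
  refine ⟨min (r / 2) (1 / 8), by positivity, min_le_right _ _, le_of_lt (h ?_)⟩
  rw [Real.dist_eq, sub_zero, abs_of_pos (by positivity)]
  exact (min_le_left _ _).trans_lt (by linarith)

/-- The final combination of the numerical bounds (pure real arithmetic). [folklore] -/
theorem combine_bounds {cardM cardB NP RP e1 e2q e2R Nd Mc Bc CP G A1 Kd T cε ε : ℝ}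
    (hM0 : 0 ≤ cardM) (hM : cardM ≤ Mc) (hB0 : 0 ≤ cardB) (hB : cardB ≤ Bc)
    (hNP0 : 0 ≤ NP) (hNP : NP ≤ CP * Nd) (hRP0 : 0 ≤ RP) (hRP : RP ≤ G * Nd) (hNd : 0 ≤ Nd)
    (hCP : 0 ≤ CP) (he10 : 0 ≤ e1) (he1 : e1 ≤ A1 + Kd)
    (he2q0 : 0 ≤ e2q) (he2 : e2q ≤ e2R) (hT : 0 ≤ T)
    (hgeo : Bc * G ≤ cε) (h1 : Mc * CP * A1 + Bc * CP * (T * e2R) ≤ ε / 3) (h2 : Mc * CP * Kd ≤ ε / 3)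
    (h3 : cε ≤ ε / 3) :
    cardM * (NP * e1) + cardB * (RP + NP * (T * e2q)) ≤ ε * Nd := by
  have hMc : 0 ≤ Mc := hM0.trans hM
  have hBc : 0 ≤ Bc := hB0.trans hB
  have hin0 : 0 ≤ RP + NP * (T * e2q) := by positivity
  have t1 : cardM * (NP * e1) ≤ Mc * ((CP * Nd) * (A1 + Kd)) :=
    mul_le_mul hM (mul_le_mul hNP he1 he10 (by positivity)) (by positivity) hMc
  have t2 : cardB * (RP + NP * (T * e2q)) ≤ Bc * (G * Nd + (CP * Nd) * (T * e2R)) :=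
    mul_le_mul hB (add_le_add hRP (mul_le_mul hNP (mul_le_mul_of_nonneg_left he2 hT)
      (by positivity) (by positivity))) hin0 hBc
  have t3 : Mc * ((CP * Nd) * (A1 + Kd)) + Bc * (G * Nd + (CP * Nd) * (T * e2R)) =
      Nd * ((Mc * CP * A1 + Bc * CP * (T * e2R)) + Mc * CP * Kd + Bc * G) := by ring
  have t4 : (Mc * CP * A1 + Bc * CP * (T * e2R)) + Mc * CP * Kd + Bc * G ≤ ε / 3 + ε / 3 + ε / 3 :=
    add_le_add (add_le_add h1 h2) (hgeo.trans h3)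
  calc cardM * (NP * e1) + cardB * (RP + NP * (T * e2q))
      ≤ Nd * ((Mc * CP * A1 + Bc * CP * (T * e2R)) + Mc * CP * Kd + Bc * G) := by
        rw [← t3]; exact add_le_add t1 t2
    _ ≤ Nd * (ε / 3 + ε / 3 + ε / 3) := mul_le_mul_of_nonneg_left t4 hNd
    _ = ε * Nd := by ring

open Classical in
/-- **Discharge** of `GreenTao2010_generalisedVonNeumann` (Green–Tao 2010, Prop. 7.1, the
generalised von Neumann theorem with a pseudorandom majorant), with `C₁ = 8` and
`D = boxDegree s t d L`. The proof follows App. C of the source with one deviation: instead of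
the Lipschitz cutoffs of Cor. A.3 and Fourier expansion (eq. (C.1)) it uses a smooth partition of
unity into `O_{d,ε}(1)` grid cells of side `≍ ε₁ N` whose cutoffs are products of one-dimensional
trapezoids `1_I ∗ μ_q ∗ μ_{-q}`; interior cells are handled by the linear change of variables
and the Gowers–Cauchy–Schwarz argument of App. C (`SplitSys.coreGvN_concrete`, with a factorisation
argument in the degenerate case of a single private coordinate), boundary cells (of which there
are `O(ε₁^{1-d})` by App. A) by the majorant and the linear forms condition, as in the source.
[cite: GreenTao2010, Prop. 7.1 and App. C] -/
theorem GreenTao2010_generalisedVonNeumann_holds : GreenTao2010_generalisedVonNeumann := by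
  intro s t d L hs ht hd hL
  obtain ⟨n, rfl⟩ : ∃ n, d = n + 1 := ⟨d - 1, by omega⟩
  refine ⟨8, by norm_num, boxDegree s t (n + 1) L, by unfold boxDegree; omega, ?_⟩
  intro C hC A ε hε
  have hC0 : 0 < C := by linarith
  -- the geometric scale `ε₁`
  obtain ⟨c₂, hc₂⟩ : ∃ c₂ : ℝ, c₂ = 12 * (n + 1) * 24 ^ n := ⟨_, rfl⟩
  have hc₂pos : 0 < c₂ := by rw [hc₂]; positivity
  obtain ⟨ε₁, hε₁⟩ : ∃ ε₁ : ℝ, ε₁ = min (1 / 32) (ε / (3 * c₂)) := ⟨_, rfl⟩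
  have hε₁pos : 0 < ε₁ := by rw [hε₁]; positivity
  have hε₁le : ε₁ ≤ 1 / 32 := by rw [hε₁]; exact min_le_left _ _
  have hε₁c : c₂ * ε₁ ≤ ε / 3 := by
    have : ε₁ ≤ ε / (3 * c₂) := by rw [hε₁]; exact min_le_right _ _
    rw [le_div_iff₀ (by positivity)] at this
    linarith
  -- the counts and the smoothing ratio
  obtain ⟨Mc, hMc⟩ : ∃ Mc : ℝ, Mc = (2 / ε₁ + 4) ^ (n + 1) := ⟨_, rfl⟩
  obtain ⟨Bc, hBc⟩ : ∃ Bc : ℝ, Bc = 6 * (n + 1) * (2 / ε₁ + 10) ^ n := ⟨_, rfl⟩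
  obtain ⟨Rm, hRm⟩ : ∃ Rm : ℝ, Rm = 8 * C / ε₁ := ⟨_, rfl⟩
  have hRm0 : 0 ≤ Rm := by rw [hRm]; positivity
  have hRm4 : 0 ≤ Rm ^ (1 / 4 : ℝ) := Real.rpow_nonneg hRm0 _
  -- `η`
  obtain ⟨η, hηpos, hη8, hηerr⟩ := exists_eta s t n Mc Bc C Rm hε
  -- `δ`
  obtain ⟨Kδ, hKδ⟩ : ∃ Kδ : ℝ, Kδ = Mc * (2 * C) ^ (n + 1) * (2 + 2 * Rm ^ (1 / 4 : ℝ)) := ⟨_, rfl⟩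
  have hMc0 : 0 ≤ Mc := by rw [hMc]; positivity
  have hBc0 : 0 ≤ Bc := by rw [hBc]; positivity
  have hKδ0 : 0 ≤ Kδ := by rw [hKδ]; positivity
  obtain ⟨δ, hδ⟩ : ∃ δ : ℝ, δ = ε / (3 * (Kδ + 1)) := ⟨_, rfl⟩
  have hδpos : 0 < δ := by rw [hδ]; positivity
  have hδerr : Kδ * δ ≤ ε / 3 := by
    rw [hδ, mul_div_assoc', div_le_div_iff₀ (by positivity) (by positivity)]
    nlinarith only [hε, hKδ0]
  -- `N₀`
  refine ⟨δ, hδpos, η, hηpos, ⌈4 / ε₁⌉₊ + L + 2, ?_⟩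
  intro N hN N' _ hp hN'lo hN'hi ν hν f hf Ψ hnd hnf hsize K hK hKN hΨK hsmall
  obtain ⟨j₀, hj₀⟩ := hsmall
  -- numerics of `N`
  have hN1 : 1 ≤ N := by omega
  have hNε : 4 / ε₁ ≤ N := by
    have h1 : (⌈4 / ε₁⌉₊ : ℝ) ≤ N := by exact_mod_cast (by omega : ⌈4 / ε₁⌉₊ ≤ N)
    exact (Nat.le_ceil _).trans h1
  have hε₁N : 4 ≤ ε₁ * N := by
    rw [div_le_iff₀ hε₁pos] at hNε; linarith only [hNε]
  have hN0r : (0 : ℝ) < N := by exact_mod_cast (by omega : 0 < N)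
  -- `ρ` and `q`
  obtain ⟨ρ, hρ⟩ : ∃ ρ : ℕ, ρ = ⌈ε₁ * N⌉₊ := ⟨_, rfl⟩
  have hρlo : ε₁ * N ≤ ρ := by rw [hρ]; exact Nat.le_ceil _
  have hρhi : (ρ : ℝ) < ε₁ * N + 1 := by rw [hρ]; exact Nat.ceil_lt_add_one (by positivity)
  have hρ4 : 4 ≤ ρ := by
    have : (4 : ℝ) ≤ ρ := hε₁N.trans hρlo
    exact_mod_cast this
  have hρ1 : 1 ≤ ρ := by omega
  have hρ2ε : (ρ : ℝ) ≤ 2 * ε₁ * N := by linarith only [hρhi, hε₁N]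
  have hρN : 16 * (ρ : ℝ) ≤ N := by
    have h := mul_le_mul_of_nonneg_right (show 2 * ε₁ ≤ 1 / 16 by linarith only [hε₁le]) hN0r.le
    linarith only [h, hρ2ε]
  obtain ⟨q, hq⟩ : ∃ q : ℕ, q = ρ / 2 := ⟨_, rfl⟩
  have hq1 : 1 ≤ q := by omega
  have h2q : 2 * q ≤ ρ := by omega
  have hqρ : q ≤ ρ := by omega
  have hqr : (ρ : ℝ) ≤ 4 * q := by
    have : ρ ≤ 4 * q := by omega
    exact_mod_cast this
  have hq0 : (0 : ℝ) < q := by exact_mod_cast (by omega : 0 < q)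
  have hqρr : (q : ℝ) ≤ ρ := by exact_mod_cast hqρ
  -- numerics of `N'`
  have hN'8 : 8 * (N : ℝ) ≤ N' := le_trans (mul_le_mul_of_nonneg_right hC (Nat.cast_nonneg N)) hN'lo
  have hNN' : N < N' := by
    have : (N : ℝ) < N' := by linarith only [hN'8, hN0r]
    exact_mod_cast this
  have h2NN' : 2 * N ≤ N' := by
    have : ((2 * N : ℕ) : ℝ) ≤ N' := by push_cast; linarith only [hN'8, hN0r]
    exact_mod_cast this
  have hLN : L < N' := by omega
  have hqN : q ≤ N' := by
    have : (q : ℝ) ≤ N' := by linarith only [hqρr, hρN, hN'8, hN0r]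
    exact_mod_cast this
  -- admissibility radius
  have hRN : 3 * ((N : ℤ) + 4 * ρ) + q < N' := by
    have : ((3 * ((N : ℤ) + 4 * ρ) + q : ℤ) : ℝ) < ((N' : ℤ) : ℝ) := by
      push_cast; linarith only [hqρr, hρN, hN'8, hN0r]
    exact_mod_cast this
  -- the Gowers bound on the extension by zero
  have hgow : gowersPower (s + 1) (extendByZero N' N (f j₀)) ≤ δ ^ 2 ^ (s + 1) :=
    (gowersPower_extendByZero_le hN1 h2NN' (f j₀)).trans
      (pow_le_pow_left₀ (uniformityNorm_nonneg _ _ _) hj₀ _)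
  -- the combined estimate
  have main := sum_cells_estimate (K := K) hs hnd hnf j₀ hL hsize hp hLN hNN' hηpos.le hη8 hν.1
    hν.2.1 le_rfl hf hKN hΨK hδpos.le hgow hρ1 hq1 hqN
    (fun m hm e => gridRange_admissible hρ1 hqρ hm e) hRN
  refine main.trans ?_
  -- the counts
  have hNρ : 2 * ((N : ℝ) / ρ) + 4 ≤ 2 / ε₁ + 4 := by
    have h1 : (N : ℝ) / ρ ≤ 1 / ε₁ := by
      rw [div_le_div_iff₀ (by positivity) hε₁pos]; linarith only [hρlo]
    have h2 : (2 : ℝ) / ε₁ = 2 * (1 / ε₁) := by ring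
    linarith only [h1, h2]
  have hMs : ((Fintype.piFinset (fun _ : Fin (n + 1) => gridRange N ρ q)).card : ℝ) ≤ Mc := by
    rw [Fintype.card_piFinset_const, Nat.cast_pow, hMc]
    exact pow_le_pow_left₀ (by positivity) ((card_gridRange_le hρ1 hqρ).trans hNρ) _
  have hBd : (((Fintype.piFinset (fun _ : Fin (n + 1) => gridRange N ρ q)).filter fun m =>
      (cellBox ρ q m ∩ K).Nonempty ∧ ¬ cellBox ρ q m ⊆ K).card : ℝ) ≤ Bc := by
    refine (card_boundaryCells_le hρ1 h2q hK hKN _ (piFinset_gridRange_subset hρ1 hqρ)).trans ?_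
    rw [hBc]
    have h0 : ((N / ρ : ℕ) : ℝ) ≤ (N : ℝ) / ρ := Nat.cast_div_le
    have h1 : (N : ℝ) / ρ ≤ 1 / ε₁ := by
      rw [div_le_div_iff₀ (by positivity) hε₁pos]; linarith only [hρlo]
    have h1' : (2 : ℝ) / ε₁ = 2 * (1 / ε₁) := by ring
    have h2 : (2 * ((N / ρ + 2 : ℕ) : ℝ) + 6) ^ n ≤ (2 / ε₁ + 10) ^ n :=
      pow_le_pow_left₀ (by positivity) (by push_cast; linarith only [h0, h1, h1']) n
    exact mul_le_mul_of_nonneg_left h2 (by positivity)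
  -- the powers of `N'` and `ρ`
  have hN'pow : (N' : ℝ) ^ (n + 1) ≤ (2 * C) ^ (n + 1) * (N : ℝ) ^ (n + 1) := by
    rw [← mul_pow]; exact pow_le_pow_left₀ (by positivity) hN'hi _
  have hρpow : (ρ : ℝ) ^ (n + 1) ≤ (2 * ε₁) ^ (n + 1) * (N : ℝ) ^ (n + 1) := by
    rw [← mul_pow]; exact pow_le_pow_left₀ (by positivity) hρ2ε _
  -- the smoothing ratio
  have hratio : (N' : ℝ) / q ≤ Rm := by
    rw [div_le_iff₀ hq0]
    have h1 : 2 * C * (N : ℝ) ≤ Rm * q := by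
      have : 2 * C * (N : ℝ) = (8 * C / ε₁) * (ε₁ * N / 4) := by field_simp; ring
      rw [this, hRm]
      exact mul_le_mul_of_nonneg_left (by linarith only [hρlo, hqr]) (by positivity)
    exact hN'hi.trans h1
  have hE1 : boxErr s η δ ((N' : ℝ) / q) ≤
      2 * (8 * η) ^ ((2 ^ (s + 2) : ℕ) : ℝ)⁻¹ + (2 + 2 * Rm ^ (1 / 4 : ℝ)) * δ := by
    refine (boxErr_mono_R s hδpos.le (by positivity) hratio).trans (le_of_eq ?_)
    unfold boxErr; ring
  have hE2 : boxErr s η (2 * η ^ ((2 ^ (s + 1) : ℕ) : ℝ)⁻¹) ((N' : ℝ) / q) ≤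
      boxErr s η (2 * η ^ ((2 ^ (s + 1) : ℕ) : ℝ)⁻¹) Rm :=
    boxErr_mono_R s (by positivity) (by positivity) hratio
  -- the geometric term
  have hgeo : Bc * ((2 * ε₁) ^ (n + 1)) ≤ c₂ * ε₁ := by
    rw [hBc, hc₂]
    have h1 : (2 / ε₁ + 10) * (2 * ε₁) ≤ 24 := by
      have : (2 / ε₁ + 10) * (2 * ε₁) = 4 + 20 * ε₁ := by field_simp; ring
      rw [this]; linarith only [hε₁le]
    have h2 : ((2 / ε₁ + 10) * (2 * ε₁)) ^ n ≤ 24 ^ n :=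
      pow_le_pow_left₀ (by positivity) h1 n
    have h2' : (2 / ε₁ + 10) ^ n * (2 * ε₁) ^ n ≤ 24 ^ n := by rw [← mul_pow]; exact h2
    have h3 : 6 * ((n : ℝ) + 1) * (2 / ε₁ + 10) ^ n * (2 * ε₁) ^ (n + 1) =
        12 * ((n : ℝ) + 1) * ((2 / ε₁ + 10) ^ n * (2 * ε₁) ^ n) * ε₁ := by
      rw [pow_succ]; ring
    rw [h3]
    have h4 : 0 ≤ 12 * ((n : ℝ) + 1) := by positivity
    exact mul_le_mul_of_nonneg_right (mul_le_mul_of_nonneg_left h2' h4) hε₁pos.le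
  -- assemble
  have hηerr' := hηerr
  rw [etaErr_eq] at hηerr'
  exact combine_bounds (Nat.cast_nonneg _) hMs (Nat.cast_nonneg _) hBd (by positivity) hN'pow
    (by positivity) hρpow (by positivity) (by positivity)
    (boxErr_nonneg s hηpos.le hδpos.le (by positivity)) hE1
    (boxErr_nonneg s hηpos.le (by positivity) (by positivity)) hE2 (by positivity)
    hgeo hηerr' (by rw [hKδ, mul_assoc] at hδerr; exact hδerr) hε₁c

/-- **The Green–Tao–Ziegler theorem from Prop. 6.4 and Thm. 7.2**: with the reductions of §4
(`GreenTao2010_main_of_mainNormalForm_holds`), §5 (`GreenTao2010_mainNormalForm_of_wTricked_holds`)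
and §7/App. C (`GreenTao2010_generalisedVonNeumann_holds`) discharged, the Main Theorem of
Green–Tao 2010 for finite complexity systems follows from the pseudorandom majorant (Prop. 6.4,
App. D) and the Gowers uniformity of the W-tricked von Mangoldt function (Thm. 7.2, from
`GI(s)` and `MN(s)`). [cite: GreenTao2010, Main Theorem, Prop. 6.4, Thm. 7.2]
[cite: GreenTaoZiegler2012, Thm. 1.3 and the following paragraph] -/
theorem GreenTaoZiegler2012_finiteComplexity_of_pseudorandomDomination_of_gowersUniformity
    (h64 : GreenTao2010_pseudorandomDomination) (hU : GreenTao2010_gowersUniformity) :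
    GreenTaoZiegler2012_finiteComplexity :=
  GreenTaoZiegler2012_finiteComplexity_of_props GreenTao2010_main_of_mainNormalForm_holds
    GreenTao2010_mainNormalForm_of_wTricked_holds h64 GreenTao2010_generalisedVonNeumann_holds hU

end final

end Literature.NumberTheory.Sieve
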